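import Summits.QuantumFields.BalabanUV.T4Continuum.Support.TermwiseHolderThm1

/-!
# TermwiseLocalThm1 — the typed Theorem 1 of [Balaban1985Variational] READ PER LEVEL: a cube of the class at level
`j` gives `HolderReg` at the spacing `(L^j)⁻¹` OF THE LEVEL — exactly the per-window background binder of
`Support/TermwiseLocalReg`

Cell `pub-balaban`, rung (B)+1 sub-cell t4, lineage `b2b-balaban-t4-ne7-p1` (node U5 = NE7, TERM-WISE member;
generation 17), record `t4/T4-EST-NE7-P1.md` §23 (23c); continues generation 16's `Support/TermwiseHolderThm1`
(ns `TermwiseHolder`).  HONEST FRAMING (page 1): FIXED FINITE T⁴, rung (B)+1, CONDITIONAL on BetaPertH and the nine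
spine estimates (0/9 proved); NOT infinite volume, NOT a mass gap, NOT the Clay problem; NE7 NOT PRINTED in
[Balaban1984PropagatorsI]–[Balaban1989LargeFieldII], NOT proved here.  [folklore] bookkeeping over r2's abstract
carrier `B11.VarProblem`, the tree's typed `B11Thm1.Thm1At` (a HYPOTHESIS wherever it appears) and generation 16's
`Realises`/`holderReg_of_thm1At`; no sentence of print is used as a fact; nothing printed is asserted.

THE POINT.  Generation 16 fed the ledger's background binder `hA9` — `HolderReg` at the UNIFORM spacing `(L^K)⁻¹` at
every site — from the typed Theorem 1 through a TOP-LEVEL covering (`holderReg_everySite_of_thm1At`: cubes with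
`L^jη = 1`).  The level-graded ledger of this generation (`TermwiseLocal.goodClause_summable_UN_levels_of_holderReg`)
asks instead, on the window box of a window of level `j`, for `HolderReg` at the spacing `(L^j)⁻¹`.  The typed (9)
(`B11.Regularity`: «|A| < B₃Mε₁(L^jη)^{−1}, |∇^ηA| < B₃Mε₁(L^jη)^{−2}, ‖A‖_{1,β} < B₄(β₀)Mε₁(L^jη)^{−2−β}», `t =
(L^jη)⁻¹`) at a cube of level `j` on the lattice of spacing `η = (L^K)⁻¹` IS that, on the nose: with `B = ηA`,
`η·(c₀t) = (ηt)·c₀`, `η²·(c₁t²) = (ηt)²·c₁`, `η²·c₂t^{2+β}·(η|x′−x|)^β = (ηt)²·c₂·((ηt)|x′−x|)^β`, and `ηt = (L^j)⁻¹`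
(`HolderReg.rescale`; the Hölder clause is asked on the smaller set of pairs `(ηt)|x′−x| ≤ 1`).  So the per-window
binder follows from the typed Theorem 1 through a PER-LEVEL covering: every site of the window box of a window of
level `j` lies `6`-deep in the ball of a cube of the class of level `j` and size `≤ Mc ≤ M(ε₁)`.

WHAT IS PROVED ([folklore]).
§16 `HolderReg.rescale` (spacing rescaling, `t ≥ 1`); **`holderReg_level_of_thm1At`** (ONE cube of level `j ≤ K`, one
    site `6`-deep in its ball: `HolderReg (cfg U) x 6 (L^j)⁻¹ (B₃Mcε₁) (B₃Mcε₁) β₀ (B₄Mcε₁)`, any `0 ≤ β₀ ≤ 1` — ONE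
    CALL of `holderReg_of_thm1At` + `rescale` + `recentre` + `mono`); **`holderReg_window_family_of_thm1At`** (family
    form over `(K, t, τ, v)`, the good terms and admissible data, windows `win K`, window boxes `box y`, level maps
    `lvl` with `lvl y ≤ K`, and the displayed PER-LEVEL COVERING `hcoverW`: CONCLUSION = LITERALLY the body of `hA9W`
    of `goodClause_summable_UN_levels_of_holderReg` for the background `(K,t,τ,v) ↦ (ρ K t τ v).cfg (U K t τ v)` with
    `a₀ = a₁ = B₃Mc`, `a₂ = B₄Mc`).

BINDER STATUS.  `hT : Thm1At C (fam …)` — the tree's typed Theorem 1, ONE block of constants for the whole family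
(r2's quantifier order) — is a HYPOTHESIS (the cell audits its printed proof elsewhere; its located leaves are the
b11/pv12 skeleton's); the realisations `ρ`, the data `V` with (7), the minimal-orbit configurations `U`, the per-level
coverings `hcoverW` (geometry of pp. 278–279: cubes of size `2ML^jη` at every level cover their domain with margin —
NOT formalised) and the identification of the ledger's `VA`/`VB` with `(ρ …).cfg (U …)` ((repr)-class) are what a
consumer supplies BY NAME.  NOT DELIVERED: any of those; anything about print.  Value = the per-window
printed-currency binder is downstream of the typed Theorem 1 per level, kernel-checked; NOT NE7, NOT summit progress.

References (LOCATIONS only): [Balaban1985Variational] T. Bałaban, Commun. Math. Phys. 102 (1985) 277–309, Theorem 1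
(7)–(10) p. 279, conditions (2) p. 278; [Balaban1985BackgroundPropagators] Commun. Math. Phys. 99 (1985) 389–434,
(3.40) p. 397.
-/

noncomputable section

open Finset
open scoped BigOperators

namespace Summit.QuantumFields.BalabanUV.T4Continuum.TermwiseHolder

open Literature.MathematicalPhysics.QuantumFieldTheory.Balaban1983to89
open B7Prop1Explicit B11 B11HolderComplex

/-! ## §16 Spacing rescaling of `HolderReg` and the typed Theorem 1 read PER LEVEL: `HolderReg` at the spacing
`(L^j)⁻¹` of the cube's own level -/

section PerLevel

variable {d : ℕ} {𝔸 : Type*} [NormedRing 𝔸] [NormOneClass 𝔸] [NormedAlgebra ℂ 𝔸] [CompleteSpace 𝔸]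

/-- **SPACING RESCALING.**  `HolderReg` at spacing `η` with constants `(c₀t, c₁t², c₂t^{2+β})`, `t ≥ 1`, IS `HolderReg`
at the coarser spacing `ηt` with constants `(c₀, c₁, c₂)`: the size and first-difference clauses by `η(c₀t) = (ηt)c₀`,
`η²(c₁t²) = (ηt)²c₁`; the Hölder clause by `η²c₂t^{2+β}(η|x′−x|)^β = (ηt)²c₂((ηt)|x′−x|)^β`, on the SMALLER set of
pairs `(ηt)|x′−x| ≤ 1`.  (With `η = (L^K)⁻¹`, `t = (L^jη)⁻¹ = L^{K−j}`: `ηt = (L^j)⁻¹` — the typed (9) at a cube of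
level `j` is `HolderReg` at the spacing of the level.) [folklore] -/
theorem HolderReg.rescale {V : B7Prop1Explicit.Site d → Fin d → 𝔸ˣ} {z : B7Prop1Explicit.Site d} {R : ℕ}
    {η t c₀ c₁ β c₂ : ℝ} (h : HolderReg V z R η (c₀ * t) (c₁ * t ^ 2) β (c₂ * t ^ (2 + β))) (hη : 0 ≤ η)
    (ht : 1 ≤ t) : HolderReg V z R (η * t) c₀ c₁ β c₂ := by
  have ht0 : 0 < t := lt_of_lt_of_le one_pos ht
  obtain ⟨u, B, hu, hrep, hB₀, hB₁, hH⟩ := h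
  refine ⟨u, B, hu, hrep, fun x κ hx => (hB₀ x κ hx).trans_eq (by ring), fun x κ ι hx => (hB₁ x κ ι hx).trans_eq
    (by ring), fun x x' hP => ?_⟩
  obtain ⟨hballs, hdist⟩ := hP
  have hl : (0 : ℝ) ≤ (l1 (x' - x) : ℝ) := Nat.cast_nonneg _
  have hdist' : η * (l1 (x' - x) : ℝ) ≤ 1 := by
    have h1 : η * (l1 (x' - x) : ℝ) ≤ η * t * (l1 (x' - x) : ℝ) := by
      rw [mul_assoc]; exact mul_le_mul_of_nonneg_left (le_mul_of_one_le_left hl ht) hη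
    exact h1.trans hdist
  refine (hH x x' ⟨hballs, hdist'⟩).trans (le_of_eq ?_)
  rw [Real.rpow_add ht0, Real.rpow_two, Real.mul_rpow (mul_nonneg hη ht0.le) hl, Real.mul_rpow hη ht0.le,
    Real.mul_rpow hη hl]
  ring

/-- **THE TYPED THEOREM 1 READ PER LEVEL (one cube, one site).**  Data: a realisation `ρ` of the abstract problem on the
lattice of spacing `η = (L^K)⁻¹` (`P.L = L ≥ 1`), the tree's typed `B11Thm1.Thm1At C P`, `ε₁ ∈ (0, a₁]`, `V` with (7),
`U` on the minimal orbit, and a cube `□` of the class AT LEVEL `j ≤ K` (`P.scale □ = j`) with `sizeM □ ≤ Mc ≤ M(ε₁)`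
whose ball covers the site `x` `6`-deep.  CONCLUSION: `HolderReg (cfg U) x 6 (L^j)⁻¹ (B₃Mcε₁) (B₃Mcε₁) β₀ (B₄Mcε₁)`
— the (9)-bounds of the cube's OWN level as `HolderReg` at the spacing `(L^j)⁻¹`, i.e. EXACTLY the per-window
background binder `hA9W`/`hB9W`/`hB9F` of `TermwiseLocal.goodClause_summable_UN_levels_of_holderReg` at a window of
level `j`.  ONE CALL of `holderReg_of_thm1At` (generation 16) + `rescale` + `recentre` + `mono`. [folklore] -/
theorem holderReg_level_of_thm1At {P : VarProblem} (ρ : Realises P d 𝔸) {L : ℕ} (hL : 1 ≤ L) {K : ℕ}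
    (hPL : P.L = (L : ℝ)) (heta : P.eta = ((L : ℝ) ^ K)⁻¹) (C : B11Thm1.Consts) (hT : B11Thm1.Thm1At C P)
    {ε₁ : ℝ} (hε₁ : 0 < ε₁) (hε₁a : ε₁ ≤ C.a₁) {V : P.Bdry} (hV : P.Reg7 ε₁ V) {U : P.Cfg}
    (hU : P.OnMinimalOrbit (C.B₃ * ε₁) V U) {Mc : ℝ} (hMc : Mc ≤ C.Mfun ε₁) {j : ℕ} (hjK : j ≤ K)
    {x : B7Prop1Explicit.Site d} {c : P.Cube} (hcj : P.scale c = j) (hcM : P.sizeM c ≤ Mc)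
    (hcx : l1 (x - ρ.centre c) + 6 ≤ ρ.radius c) {β₀ : ℝ} (hβ₀ : 0 ≤ β₀) (hβ₀1 : β₀ ≤ 1) :
    HolderReg (ρ.cfg U) x 6 (((L : ℝ) ^ j)⁻¹) (C.B₃ * Mc * ε₁) (C.B₃ * Mc * ε₁) β₀ (C.B₄ * Mc * ε₁) := by
  have hL1 : (1 : ℝ) ≤ L := by exact_mod_cast hL
  have hL0 : (0 : ℝ) < L := by linarith
  have hη : 0 ≤ P.eta := by rw [heta]; positivity
  have h := holderReg_of_thm1At ρ hη C hT hε₁ hε₁a hV hU (hcM.trans hMc) hβ₀ hβ₀1 (c := c)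
  -- the width `t = (L^j η)⁻¹ = L^{K−j} ≥ 1`, and `η t = (L^j)⁻¹`
  have hsplit : (L : ℝ) ^ K = (L : ℝ) ^ j * (L : ℝ) ^ (K - j) := by rw [← pow_add, Nat.add_sub_cancel' hjK]
  have ht : (P.L ^ P.scale c * P.eta)⁻¹ = (L : ℝ) ^ (K - j) := by
    rw [hPL, hcj, heta, hsplit, mul_inv, inv_inv, ← mul_assoc, inv_mul_cancel₀ (pow_ne_zero _ hL0.ne'), one_mul]
  have ht1 : (1 : ℝ) ≤ (L : ℝ) ^ (K - j) := one_le_pow₀ hL1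
  have hηt : P.eta * (L : ℝ) ^ (K - j) = ((L : ℝ) ^ j)⁻¹ := by
    rw [heta, hsplit, mul_inv, mul_assoc, inv_mul_cancel₀ (pow_ne_zero _ hL0.ne'), mul_one]
  rw [ht, pow_one] at h
  have h' := h.rescale (c₀ := C.B₃ * P.sizeM c * ε₁) (c₁ := C.B₃ * P.sizeM c * ε₁) (c₂ := C.B₄ * P.sizeM c * ε₁)
    hη ht1
  rw [hηt] at h'
  refine (h'.recentre hcx).mono (by positivity) ?_ ?_ ?_
  · exact mul_le_mul_of_nonneg_right (mul_le_mul_of_nonneg_left hcM C.B₃_pos.le) hε₁.le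
  · exact mul_le_mul_of_nonneg_right (mul_le_mul_of_nonneg_left hcM C.B₃_pos.le) hε₁.le
  · exact mul_le_mul_of_nonneg_right (mul_le_mul_of_nonneg_left hcM C.B₄_pos.le) hε₁.le

/-- **THE PER-WINDOW BINDER FROM THE TYPED THEOREM 1 (family form).**  A family of variational problems `fam K t τ v`
(one run's problem at cutoff `K` on the good term `τ` with datum `v`), on the lattice of spacing `(L^K)⁻¹` with `P.L = L`,
realisations `ρ`, the typed Theorem 1 at ONE block of constants `C` for every member, `ε₁ ∈ (0, a₁]`, data `V` with (7),
configurations `U` on the minimal orbits, one size bound `Mc ≤ M(ε₁)`, and A PER-LEVEL COVERING (displayed binder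
`hcoverW`): every site `x` of the window box of every window `y` lies `6`-deep in the ball of a cube of the class AT THE
WINDOW's LEVEL `lvl K t τ v y ≤ K`.  CONCLUSION: LITERALLY the body of `hA9W` of
`TermwiseLocal.goodClause_summable_UN_levels_of_holderReg` for the background `(K,t,τ,v) ↦ (ρ K t τ v).cfg (U K t τ v)`,
with `a₀ = a₁ = B₃Mc`, `a₂ = B₄Mc`.  What a consumer still supplies BY NAME: the identification of the ledger's `VA`
with this background ((repr)-class), the realisations, the per-level coverings, and `hT` itself. [folklore] -/
theorem holderReg_window_family_of_thm1At {σ : Type*} [DecidableEq σ] {ι : Type} {l₀ : ℝ} {T : ℕ → Finset σ}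
    {Bad : ℕ → ℝ → Finset σ} {Adm : Set ι} {W : Type*} (L : ℕ) (hL : 1 ≤ L)
    (fam : ℕ → ℝ → σ → ι → VarProblem) (ρ : ∀ K t τ v, Realises (fam K t τ v) d 𝔸)
    (hPL : ∀ K t τ v, (fam K t τ v).L = (L : ℝ)) (heta : ∀ K t τ v, (fam K t τ v).eta = ((L : ℝ) ^ K)⁻¹)
    (C : B11Thm1.Consts) (hT : ∀ K t τ v, B11Thm1.Thm1At C (fam K t τ v)) {ε₁ : ℝ} (hε₁ : 0 < ε₁)
    (hε₁a : ε₁ ≤ C.a₁) (V : ∀ K t τ v, (fam K t τ v).Bdry) (hV : ∀ K t τ v, (fam K t τ v).Reg7 ε₁ (V K t τ v))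
    (U : ∀ K t τ v, (fam K t τ v).Cfg)
    (hU : ∀ K t τ v, (fam K t τ v).OnMinimalOrbit (C.B₃ * ε₁) (V K t τ v) (U K t τ v)) {Mc : ℝ}
    (hMc : Mc ≤ C.Mfun ε₁) (win : ℕ → Finset W) (box : W → B7Prop1Explicit.Site d → Prop)
    (lvl : ℕ → ℝ → σ → ι → W → ℕ) (hlvl : ∀ K t τ v, ∀ y ∈ win K, lvl K t τ v y ≤ K)
    (hcoverW : ∀ K t, |t| ≤ l₀ → ∀ τ ∈ T K \ Bad K t, ∀ v ∈ Adm, ∀ y ∈ win K, ∀ x, box y x →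
      ∃ c : (fam K t τ v).Cube, (fam K t τ v).scale c = lvl K t τ v y ∧ (fam K t τ v).sizeM c ≤ Mc ∧
        l1 (x - (ρ K t τ v).centre c) + 6 ≤ (ρ K t τ v).radius c)
    {β₀ : ℝ} (hβ₀ : 0 ≤ β₀) (hβ₀1 : β₀ ≤ 1) :
    ∀ K t, |t| ≤ l₀ → ∀ τ ∈ T K \ Bad K t, ∀ v ∈ Adm, ∀ y ∈ win K, ∀ x, box y x →
      HolderReg ((ρ K t τ v).cfg (U K t τ v)) x 6 (((L : ℝ) ^ lvl K t τ v y)⁻¹)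
        (C.B₃ * Mc * ε₁) (C.B₃ * Mc * ε₁) β₀ (C.B₄ * Mc * ε₁) := by
  intro K t ht τ hτ v hv y hy x hx
  obtain ⟨c, hcj, hcM, hcx⟩ := hcoverW K t ht τ hτ v hv y hy x hx
  exact holderReg_level_of_thm1At (ρ K t τ v) hL (hPL K t τ v) (heta K t τ v) C (hT K t τ v) hε₁ hε₁a
    (hV K t τ v) (hU K t τ v) hMc (hlvl K t τ v y hy) hcj hcM hcx hβ₀ hβ₀1

end PerLevel

end Summit.QuantumFields.BalabanUV.T4Continuum.TermwiseHolder
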